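import Mathlib
import Summits.Parity.BatemanHorn.Theses.IsogenyRedei
import Summits.Parity.BatemanHorn.Theorems.PolyMobiusTail.Negative.Equivalence
import Summits.Parity.BatemanHorn.Theorems.IsogenyRedeiTypeIMainTerm
import Literature.NumberTheory.LFunctions.PrimeNumberTheoremProgressions
import Literature.NumberTheory.Sieve.AletheiaZomleferFukshanskyGarcia2020Applications

/-!
# Crux `PolyMobiusTail` (stmt-Parity-0870), line `Sketch`: the degree-one slice is a theorem

Lead prover `prover-line-stmt-Parity-0870-c2-0`, stub `stub_degreeOneSlice` of skeleton v8.

The crux `PolyMobiusTail` (for every Bateman–Horn system some `η ∈ (0,1)` makes the Möbius tail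
`Σ_{n≤x} Σ_{dᵢ∣fᵢ(n), ∏dᵢ > x^{1-η}} ∏ μ(dᵢ) log dᵢ` an `o(x)`) is, with the Type-I main term proved
(`typeIMainTerm_proof`, stmt-Parity-0873), `Λ`-form Bateman–Horn for every system
(`Negative/Equivalence.lean`).  Bateman–Horn is a THEOREM in exactly one case: one polynomial of degree one,
`f = (qX + a)` with `q ≥ 1`, `gcd(q, a) = 1` — Dirichlet / de la Vallée Poussin, the prime number theorem for
arithmetic progressions.  This file proves the crux on that whole slice, for EVERY `η ∈ (0,1)`:

* `DegreeOne.polyRootCountMod_eq`, `DegreeOne.hasBatemanHornConst` — for a degree-one Bateman–Horn system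
  `ω_f(p) = [p ∤ q]·1`, so the ordered Euler product is eventually the finite product
  `∏_{p ∣ q} (1 - 1/p)⁻¹ = q/φ(q)` (the integer-constant-term version of
  `Literature.NumberTheory.Sieve.hasBatemanHornConst_linear`);
* `DegreeOne.sum_vonMangoldt_linear_eq` — the sampling identity
  `Σ_{n≤x} Λ(qn+a) = ψ(qx+a; q, a) - ψ(a; q, a)` (exact, all `x`, `a ∈ ℤ`, values `≤ 0` sent to `Λ(0) = 0`);
* `DegreeOne.sum_vonMangoldt_linear_isEquivalent` — hence `Σ_{n≤x} Λ(qn+a) ∼ (q/φ(q))·x` from the tree's PNT in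
  progressions `Literature.NumberTheory.LFunctions.vonMangoldt_residueClass_sum_isLittleO` (Wiener–Ikehara,
  proved there);
* `stub_degreeOneSlice` — the tail of a degree-one system is `o(x)` at every `η ∈ (0,1)`: subtract the two
  `∼ (q/φ(q))·x` asymptotics (`Negative.tail_isLittleO_of_isEquivalent`), the Type-I one being
  `typeIMainTerm_proof` with its constant identified by uniqueness of the ordered Euler-product limit.

So the crux holds on precisely the systems for which Bateman–Horn is known; everything here is proved.
[folklore]
-/

open scoped BigOperators
open Filter Finset Polynomial Asymptotics

namespace Summit.Parity.BatemanHorn.Theorems.PolyMobiusTail.NaturalForm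

open Literature.NumberTheory.Sieve

namespace DegreeOne

/-! ### The linear polynomial behind a degree-one system -/

section Shape

variable {f : Fin 1 → ℤ[X]}

/-- A degree-one polynomial evaluates as `q·n + a` with `q` its leading coefficient and `a` its constant
term. [folklore] -/
theorem eval_eq (hdeg : (f 0).natDegree = 1) (n : ℤ) :
    (f 0).eval n = (f 0).leadingCoeff * n + (f 0).coeff 0 := by
  have h := eq_X_add_C_of_natDegree_le_one (p := f 0) hdeg.le
  have hlc : (f 0).leadingCoeff = (f 0).coeff 1 := by rw [leadingCoeff, hdeg]
  conv_lhs => rw [h]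
  rw [eval_add, eval_mul, eval_C, eval_X, eval_C, hlc]

/-- The product over `Fin 1` of the values is the single value `q·n + a`. [folklore] -/
theorem prod_eval_eq (hdeg : (f 0).natDegree = 1) (n : ℤ) :
    ∏ i, (f i).eval n = (f 0).leadingCoeff * n + (f 0).coeff 0 := by
  rw [Fin.prod_univ_one, eval_eq hdeg]

/-- No fixed prime divisor forces `gcd(q, a) = 1`: a prime dividing the leading coefficient does not
divide the constant term. [folklore] -/
theorem not_dvd_coeff_zero (hf : IsBatemanHornSystem f) (hdeg : (f 0).natDegree = 1) {p : ℕ}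
    (hp : p.Prime) (hpq : (p : ℤ) ∣ (f 0).leadingCoeff) : ¬ (p : ℤ) ∣ (f 0).coeff 0 := by
  intro hpa
  have hlt := hf.hasNoFixedPrimeDivisor p hp
  unfold polyRootCountMod at hlt
  have hall : ((range p).filter fun n : ℕ => (p : ℤ) ∣ ∏ i, (f i).eval (n : ℤ)) = range p := by
    refine Finset.filter_true_of_mem fun n _ => ?_
    rw [prod_eval_eq hdeg]
    exact (hpq.mul_right _).add hpa
  rw [hall, card_range] at hlt
  exact lt_irrefl _ hlt

/-- `ω_f(p)` for a degree-one Bateman–Horn system `(qX + a)`: no root modulo `p ∣ q` (as then `p ∤ a`),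
exactly one root modulo `p ∤ q`. [folklore] -/
theorem polyRootCountMod_eq (hf : IsBatemanHornSystem f) (hdeg : (f 0).natDegree = 1) {p : ℕ}
    (hp : p.Prime) : polyRootCountMod f p = if (p : ℤ) ∣ (f 0).leadingCoeff then 0 else 1 := by
  haveI := Fact.mk hp
  set q : ℤ := (f 0).leadingCoeff with hq
  set a : ℤ := (f 0).coeff 0 with ha
  unfold polyRootCountMod
  have hcast : ∀ n : ℕ, ((p : ℤ) ∣ ∏ i, (f i).eval (n : ℤ)) ↔ ((q : ZMod p) * n + (a : ZMod p) = 0) := by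
    intro n
    rw [prod_eval_eq hdeg, ← ZMod.intCast_zmod_eq_zero_iff_dvd]
    push_cast
    rfl
  simp_rw [hcast]
  split_ifs with hpq
  · rw [card_eq_zero, filter_eq_empty_iff]
    intro n _ h0
    rw [(ZMod.intCast_zmod_eq_zero_iff_dvd q p).mpr hpq, zero_mul, zero_add,
      ZMod.intCast_zmod_eq_zero_iff_dvd] at h0
    exact not_dvd_coeff_zero hf hdeg hp hpq h0
  · have hq0 : (q : ZMod p) ≠ 0 := by rwa [Ne, ZMod.intCast_zmod_eq_zero_iff_dvd]
    set r : ZMod p := -(a : ZMod p) / q with hr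
    have hset : (range p).filter (fun n : ℕ => (q : ZMod p) * n + a = 0) = {r.val} := by
      ext n
      simp only [mem_filter, mem_range, mem_singleton]
      constructor
      · rintro ⟨hn, h0⟩
        have : (n : ZMod p) = r := by
          rw [hr, eq_div_iff hq0]
          linear_combination h0
        rw [← this, ZMod.val_natCast, Nat.mod_eq_of_lt hn]
      · rintro rfl
        refine ⟨ZMod.val_lt r, ?_⟩
        rw [ZMod.natCast_zmod_val, hr]
        field_simp
        ring
    rw [hset, card_singleton]

/-- The leading coefficient of a Bateman–Horn member, as a natural number, is positive and casts back.
[folklore] -/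
theorem leadingCoeff_toNat (hf : IsBatemanHornSystem f) :
    0 < (f 0).leadingCoeff.toNat ∧ (((f 0).leadingCoeff.toNat : ℕ) : ℤ) = (f 0).leadingCoeff := by
  have hq : 0 < (f 0).leadingCoeff := hf.leadingCoeff_pos 0
  exact ⟨by omega, Int.toNat_of_nonneg hq.le⟩

/-- The ordered Bateman–Horn partial products of a degree-one system are eventually the finite product
`∏_{p ∣ q} (1 - 1/p)⁻¹ = q/φ(q)`. [folklore] -/
theorem batemanHornPartial_eq (hf : IsBatemanHornSystem f) (hdeg : (f 0).natDegree = 1) {x : ℕ}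
    (hx : (f 0).leadingCoeff.toNat ≤ x) :
    batemanHornPartial f x =
      ((f 0).leadingCoeff.toNat : ℝ) / Nat.totient (f 0).leadingCoeff.toNat := by
  obtain ⟨hQpos, hQq⟩ := leadingCoeff_toNat hf
  set Q : ℕ := (f 0).leadingCoeff.toNat with hQ
  rw [← prod_primeFactors_inv_eq_div_totient hQpos]
  unfold batemanHornPartial
  rw [Fintype.card_fin]
  have h1 : ∀ p ∈ Nat.primesLE x, (1 - 1 / (p : ℝ))⁻¹ ^ 1 *
      (1 - (polyRootCountMod f p : ℝ) / p) = if p ∣ Q then (1 - 1 / (p : ℝ))⁻¹ else 1 := by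
    intro p hp
    have hpp := (Nat.mem_primesLE.mp hp).2
    have hdvd : ((p : ℤ) ∣ (f 0).leadingCoeff) ↔ p ∣ Q := by
      rw [← hQq, Int.natCast_dvd_natCast]
    rw [polyRootCountMod_eq hf hdeg hpp, pow_one]
    by_cases h : p ∣ Q
    · rw [if_pos (hdvd.mpr h), if_pos h]
      simp
    · rw [if_neg (mt hdvd.mp h), if_neg h]
      have hp0 : (0 : ℝ) < p := by exact_mod_cast hpp.pos
      have hne : (1 : ℝ) - 1 / p ≠ 0 := by
        rw [sub_ne_zero, ne_comm, ne_eq, div_eq_one_iff_eq hp0.ne']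
        have : (1 : ℝ) < p := by exact_mod_cast hpp.one_lt
        linarith
      push_cast
      rw [inv_mul_cancel₀ hne]
  rw [prod_congr rfl h1, prod_ite, prod_const_one, mul_one]
  refine prod_congr ?_ fun _ _ => rfl
  ext p
  simp only [mem_filter, Nat.mem_primesLE, Nat.mem_primeFactors, ne_eq]
  constructor
  · rintro ⟨⟨-, hp⟩, hpa⟩
    exact ⟨hp, hpa, hQpos.ne'⟩
  · rintro ⟨hp, hpa, -⟩
    exact ⟨⟨(Nat.le_of_dvd hQpos hpa).trans hx, hp⟩, hpa⟩

/-- The Bateman–Horn constant of a degree-one system `(qX + a)` is `q/φ(q)` (ordered limit of an eventually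
constant sequence). [folklore] -/
theorem hasBatemanHornConst (hf : IsBatemanHornSystem f) (hdeg : (f 0).natDegree = 1) :
    HasBatemanHornConst f (((f 0).leadingCoeff.toNat : ℝ) / Nat.totient (f 0).leadingCoeff.toNat) := by
  unfold HasBatemanHornConst
  refine tendsto_const_nhds.congr' ?_
  filter_upwards [eventually_ge_atTop (f 0).leadingCoeff.toNat] with x hx
  exact (batemanHornPartial_eq hf hdeg hx).symm

end Shape

/-! ### `Λ` along an arithmetic progression: the sampling identity and its asymptotic -/

section Lambda

variable (q a : ℤ)

/-- One step of the sampling identity: between `(qx + a)⁺` and `(q(x+1) + a)⁺` the only integer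
`≡ a (mod q)` carrying a `Λ` is `q(x+1) + a` itself (when positive). [folklore] -/
theorem sum_Ioc_residueClass_step (hq : 0 < q) (x : ℕ) :
    ∑ m ∈ Ioc (q * x + a).toNat (q * (x + 1) + a).toNat,
        ArithmeticFunction.vonMangoldt.residueClass (a : ZMod q.toNat) m
      = ArithmeticFunction.vonMangoldt (q * (x + 1) + a).toNat := by
  set Q : ℕ := q.toNat with hQ
  have hQq : (Q : ℤ) = q := Int.toNat_of_nonneg hq.le
  by_cases hN : q * (x + 1) + a ≤ 0
  · -- nothing to count
    have h0 : (q * (x + 1) + a).toNat = 0 := Int.toNat_eq_zero.mpr hN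
    rw [h0]
    simp
  push Not at hN
  set N : ℕ := (q * (x + 1) + a).toNat with hNdef
  have hNZ : (N : ℤ) = q * (x + 1) + a := Int.toNat_of_nonneg hN.le
  have hN1 : 1 ≤ N := by omega
  -- the top index
  have htop : (q * x + a).toNat ≤ N - 1 := by
    have : ((q * x + a).toNat : ℤ) ≤ (N : ℤ) - 1 := by
      rcases le_or_gt 0 (q * x + a) with h | h
      · rw [Int.toNat_of_nonneg h]; nlinarith
      · rw [Int.toNat_eq_zero.mpr h.le]; push_cast; omega
    omega
  have hsplit : Ioc (q * x + a).toNat N = Ioc (q * x + a).toNat (N - 1 + 1) := by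
    rw [Nat.sub_add_cancel hN1]
  rw [hsplit, sum_Ioc_succ_top htop, Nat.sub_add_cancel hN1]
  -- the intermediate terms vanish
  have hmid : ∑ m ∈ Ioc (q * x + a).toNat (N - 1),
      ArithmeticFunction.vonMangoldt.residueClass (a : ZMod Q) m = 0 := by
    refine sum_eq_zero fun m hm => ?_
    obtain ⟨hm1, hm2⟩ := mem_Ioc.mp hm
    simp only [ArithmeticFunction.vonMangoldt.residueClass, Set.indicator_apply_eq_zero,
      Set.mem_setOf_eq]
    intro hma
    exfalso
    -- `Q ∣ N - m` with `0 < N - m < Q`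
    have hdvd : (Q : ℤ) ∣ (N : ℤ) - m := by
      rw [← ZMod.intCast_zmod_eq_zero_iff_dvd]
      push_cast
      rw [hma, ← Int.cast_natCast (R := ZMod Q) N, hNZ]
      push_cast
      rw [← hQq]
      push_cast
      rw [ZMod.natCast_self, zero_mul, zero_add, sub_self]
    have hlow : ((q * x + a).toNat : ℤ) ≥ q * x + a := Int.self_le_toNat _
    have h1 : (0 : ℤ) < (N : ℤ) - m := by omega
    have h2 : (N : ℤ) - m < Q := by
      rw [hQq]
      have : ((q * x + a).toNat : ℤ) < m := by exact_mod_cast hm1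
      have hmul : q * ((x : ℤ) + 1) = q * x + q := by ring
      omega
    obtain ⟨c, hc⟩ := hdvd
    have hQpos : (0 : ℤ) < Q := by rw [hQq]; exact hq
    have hc1 : 0 < c := by
      by_contra hc0; push Not at hc0
      have : (Q : ℤ) * c ≤ 0 := mul_nonpos_of_nonneg_of_nonpos hQpos.le hc0
      omega
    have : (Q : ℤ) * 1 ≤ (Q : ℤ) * c := mul_le_mul_of_nonneg_left hc1 hQpos.le
    omega
  rw [hmid, zero_add]
  -- the top term is `Λ(N)` since `N ≡ a (mod q)`
  simp only [ArithmeticFunction.vonMangoldt.residueClass, Set.indicator_apply, Set.mem_setOf_eq]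
  rw [if_pos]
  have : ((N : ℕ) : ZMod Q) = ((N : ℤ) : ZMod Q) := by push_cast; rfl
  rw [this, hNZ, ← hQq]
  push_cast
  rw [ZMod.natCast_self, zero_mul, zero_add]

/-- **Sampling identity.** For `q ≥ 1`, `a ∈ ℤ` and every `x`:
`Σ_{1 ≤ n ≤ x} Λ((qn + a)⁺) = ψ((qx + a)⁺; q, a) - ψ(a⁺; q, a)` with
`ψ(N; q, a) = Σ_{1 ≤ m ≤ N, m ≡ a (q)} Λ(m)` (values `qn + a ≤ 0` contribute `Λ(0) = 0`). [folklore] -/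
theorem sum_vonMangoldt_linear_eq (hq : 0 < q) (x : ℕ) :
    ∑ n ∈ Icc 1 x, ArithmeticFunction.vonMangoldt (q * n + a).toNat
      = ∑ m ∈ Icc 1 (q * x + a).toNat, ArithmeticFunction.vonMangoldt.residueClass (a : ZMod q.toNat) m
        - ∑ m ∈ Icc 1 a.toNat, ArithmeticFunction.vonMangoldt.residueClass (a : ZMod q.toNat) m := by
  induction x with
  | zero => simp
  | succ x ih =>
    rw [sum_Icc_succ_top (Nat.le_add_left 1 x), ih]
    have hmono : (q * x + a).toNat ≤ (q * (x + 1 : ℕ) + a).toNat := by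
      apply Int.toNat_le_toNat; push_cast; nlinarith
    have hIcc : ∀ N : ℕ, Icc 1 N = Ioc 0 N := fun N => rfl
    rw [hIcc, hIcc, hIcc, ← sum_Ioc_consecutive _ (Nat.zero_le _) hmono]
    push_cast
    rw [sum_Ioc_residueClass_step q a hq x]
    ring

/-- `Σ_{1 ≤ n ≤ x} Λ((qn + a)⁺) ∼ (q/φ(q))·x` for `q ≥ 1`, `gcd(q, a) = 1`: the prime number theorem for the
progression `a (mod q)` (tree: `vonMangoldt_residueClass_sum_isLittleO`, Wiener–Ikehara) transported through
the sampling identity. [folklore] -/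
theorem sum_vonMangoldt_linear_isEquivalent (hq : 0 < q) (ha : IsUnit (a : ZMod q.toNat)) :
    (fun x : ℕ => ∑ n ∈ Icc 1 x, ArithmeticFunction.vonMangoldt (q * n + a).toNat)
      ~[atTop] fun x : ℕ => ((q.toNat : ℝ) / Nat.totient q.toNat) * (x : ℝ) := by
  have hid := sum_vonMangoldt_linear_eq q a hq
  set Q : ℕ := q.toNat with hQ
  have hQq : (Q : ℤ) = q := Int.toNat_of_nonneg hq.le
  have hQpos : 0 < Q := by omega
  haveI : NeZero Q := ⟨hQpos.ne'⟩
  have hφ : (0 : ℝ) < Nat.totient Q := by exact_mod_cast Nat.totient_pos.mpr hQpos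
  set T : ℕ → ℕ := fun x => (q * x + a).toNat with hT
  set ψ : ℕ → ℝ := fun N => ∑ m ∈ Icc 1 N, ArithmeticFunction.vonMangoldt.residueClass (a : ZMod Q) m
    with hψ
  -- PNT in the progression, along `T x → ∞`
  have hTx : ∀ x : ℕ, x - a.natAbs ≤ T x := by
    intro x
    have h1 : (x : ℤ) - a.natAbs ≤ q * x + a := by
      have : (x : ℤ) ≤ q * x := by nlinarith
      have : -(a.natAbs : ℤ) ≤ a := by omega
      omega
    have h2 : ((x - a.natAbs : ℕ) : ℤ) ≤ (((q * x + a).toNat : ℕ) : ℤ) := by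
      rcases le_or_gt a.natAbs x with h | h
      · rw [Nat.cast_sub h]
        exact h1.trans (Int.self_le_toNat _)
      · rw [Nat.sub_eq_zero_of_le h.le, Nat.cast_zero]
        exact Int.natCast_nonneg _
    exact_mod_cast h2
  have hTtop : Tendsto T atTop atTop :=
    tendsto_atTop_mono hTx (tendsto_sub_atTop_nat a.natAbs)
  have h1 : (fun x : ℕ => ψ (T x) - (Nat.totient Q : ℝ)⁻¹ * (T x : ℝ)) =o[atTop]
      fun x : ℕ => ((T x : ℕ) : ℝ) :=
    (Literature.NumberTheory.LFunctions.vonMangoldt_residueClass_sum_isLittleO ha).comp_tendsto hTtop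
  -- `T x = O(x)`
  have h2 : (fun x : ℕ => ((T x : ℕ) : ℝ)) =O[atTop] fun x : ℕ => (x : ℝ) := by
    refine IsBigO.of_bound ((Q : ℝ) + a.toNat) ?_
    filter_upwards [eventually_ge_atTop 1] with x hx
    rw [Real.norm_eq_abs, Real.norm_eq_abs, abs_of_nonneg (Nat.cast_nonneg _),
      abs_of_nonneg (Nat.cast_nonneg _)]
    have hle : (T x : ℤ) ≤ Q * x + a.toNat := by
      have ha' : a ≤ a.toNat := Int.self_le_toNat a
      have h0 : (0 : ℤ) ≤ Q * x + a.toNat := by positivity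
      rcases le_or_gt 0 (q * x + a) with h | h
      · simp only [hT]; rw [Int.toNat_of_nonneg h, ← hQq]; omega
      · simp only [hT]; rw [Int.toNat_eq_zero.mpr h.le]; exact_mod_cast h0
    have hle' : (T x : ℝ) ≤ Q * x + a.toNat := by exact_mod_cast hle
    have hx1 : (1 : ℝ) ≤ x := by exact_mod_cast hx
    nlinarith [hle', hx1, (Nat.cast_nonneg a.toNat : (0 : ℝ) ≤ a.toNat)]
  -- the main terms differ by an eventually constant amount
  have h3 : (fun x : ℕ => (Nat.totient Q : ℝ)⁻¹ * (T x : ℝ) - (Q : ℝ) / Nat.totient Q * x) =o[atTop]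
      fun x : ℕ => (x : ℝ) := by
    have hc : (fun x : ℕ => (Nat.totient Q : ℝ)⁻¹ * (a : ℝ)) =o[atTop] fun x : ℕ => (x : ℝ) := by
      refine isLittleO_const_left.mpr (Or.inr ?_)
      exact tendsto_norm_atTop_atTop.comp tendsto_natCast_atTop_atTop
    refine hc.congr' ?_ EventuallyEq.rfl
    filter_upwards [eventually_ge_atTop a.natAbs] with x hx
    have hpos : 0 ≤ q * x + a := by
      have : (x : ℤ) ≤ q * x := by nlinarith
      omega
    have hTZ : ((T x : ℕ) : ℝ) = (q : ℝ) * x + a := by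
      have : ((T x : ℕ) : ℤ) = q * x + a := Int.toNat_of_nonneg hpos
      exact_mod_cast this
    have hqQ : (q : ℝ) = (Q : ℝ) := by exact_mod_cast hQq.symm
    rw [hTZ, hqQ]
    field_simp
    ring
  -- the constant `ψ(a⁺; q, a)`
  have h4 : (fun _ : ℕ => ψ a.toNat) =o[atTop] fun x : ℕ => (x : ℝ) := by
    refine isLittleO_const_left.mpr (Or.inr ?_)
    exact tendsto_norm_atTop_atTop.comp tendsto_natCast_atTop_atTop
  -- assemble
  have hsum := ((h1.trans_isBigO h2).add h3).sub h4
  have hkey : (fun x : ℕ => ∑ n ∈ Icc 1 x, ArithmeticFunction.vonMangoldt (q * n + a).toNat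
      - (Q : ℝ) / Nat.totient Q * x) =o[atTop] fun x : ℕ => (x : ℝ) := by
    refine hsum.congr' (Eventually.of_forall fun x => ?_) EventuallyEq.rfl
    simp only [hψ, hT]
    rw [hid x]
    ring
  have hQne : (Q : ℝ) / Nat.totient Q ≠ 0 := div_ne_zero (by exact_mod_cast hQpos.ne') hφ.ne'
  exact hkey.trans_isBigO (isBigO_self_const_mul hQne (fun x : ℕ => (x : ℝ)) atTop)

end Lambda

end DegreeOne

/-- **STUB `stub_degreeOneSlice` (line `Sketch`, skeleton v8): the crux holds on the whole degree-one slice.**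
For every Bateman–Horn system consisting of ONE polynomial of degree `1` — i.e. `f = (qX + a)`, `q ≥ 1`,
`gcd(q, a) = 1`, exactly the systems for which Bateman–Horn is a theorem (Dirichlet, de la Vallée Poussin) —
and EVERY `η ∈ (0,1)`, the Möbius tail `Σ_{n≤x} Σ_{d ∣ f(n), d > x^{1-η}} μ(d) log d` is `o(x)`.
Proof: `Σ_{n≤x} Λ(qn+a) ∼ (q/φ(q))·x` (PNT in progressions, `DegreeOne.sum_vonMangoldt_linear_isEquivalent`)
and `-TypeI_η(x) ∼ C(f)·x` (`typeIMainTerm_proof`) with `C(f) = q/φ(q)` (`DegreeOne.hasBatemanHornConst`,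
uniqueness of the ordered limit); subtract (`Negative.tail_isLittleO_of_isEquivalent`). [folklore] -/
theorem stub_degreeOneSlice : ∀ (f : Fin 1 → ℤ[X]),
    Literature.NumberTheory.Sieve.IsBatemanHornSystem f → (f 0).natDegree = 1 →
      ∀ η : ℝ, 0 < η → η < 1 →
        (fun x : ℕ => ∑ n ∈ Finset.Icc 1 x,
          ∑ d ∈ Fintype.piFinset (fun i => (((f i).eval (n : ℤ)).toNat).divisors),
            if (x : ℝ) ^ (1 - η) < ∏ i, (d i : ℝ) then
              ∏ i, ((ArithmeticFunction.moebius (d i) : ℝ) * Real.log (d i)) else 0)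
          =o[atTop] fun x : ℕ => (x : ℝ) := by
  intro f hf hdeg η hη0 hη1
  obtain ⟨C, -, hHas, hM⟩ := Summit.Parity.BatemanHorn.Theorems.typeIMainTerm_proof 1 f hf η hη0 hη1
  have hCC : C = ((f 0).leadingCoeff.toNat : ℝ) / Nat.totient (f 0).leadingCoeff.toNat :=
    tendsto_nhds_unique hHas (DegreeOne.hasBatemanHornConst hf hdeg)
  subst hCC
  refine Negative.tail_isLittleO_of_isEquivalent f ?_ hM
  -- the `Λ`-side: `Σ_{n≤x} Λ(f(n)) ∼ (q/φ(q))·x`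
  set q : ℤ := (f 0).leadingCoeff with hq
  set a : ℤ := (f 0).coeff 0 with ha
  have hqpos : 0 < q := hf.leadingCoeff_pos 0
  obtain ⟨hQpos, hQq⟩ := DegreeOne.leadingCoeff_toNat hf
  -- `gcd(q, a) = 1`
  have hgcd : Int.gcd q a = 1 := by
    by_contra hne
    obtain ⟨p, hp, hpg⟩ := Nat.exists_prime_and_dvd hne
    have hpg' : (p : ℤ) ∣ (Int.gcd q a : ℤ) := Int.natCast_dvd_natCast.mpr hpg
    exact DegreeOne.not_dvd_coeff_zero hf hdeg hp (hpg'.trans (Int.gcd_dvd_left q a))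
      (hpg'.trans (Int.gcd_dvd_right q a))
  have hunit : IsUnit (a : ZMod q.toNat) := by
    rw [ZMod.coe_int_isUnit_iff_isCoprime, hQq, Int.isCoprime_iff_gcd_eq_one]
    exact hgcd
  have hΛ := DegreeOne.sum_vonMangoldt_linear_isEquivalent q a hqpos hunit
  refine hΛ.congr_left (Eventually.of_forall fun x => ?_)
  refine Finset.sum_congr rfl fun n _ => ?_
  rw [Fin.prod_univ_one, DegreeOne.eval_eq hdeg]

end Summit.Parity.BatemanHorn.Theorems.PolyMobiusTail.NaturalForm
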